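import Summits.Schanuel.Schanuel.Theorems.ZilberEacHyperellipticPoleFibres
import Summits.Schanuel.Schanuel.Theorems.ZilberEacHyperellipticSheetCase
import HarnessLib

/-!
# Arbitrary base branches, LI: EVERY non-constant polynomial fibre `y₀ = R(x₀, x₁)` over EVERY
# curve `x₁² = P(x₀)`, `deg P ≠ 2` — case ∧ dense

HONEST FRAMING.  Cell `pub-schanuel` (Zilber's Exponential-Algebraic Closedness, case ladder;
host summit Schanuel), seat 2, gen 30.  Over `C : x₁² = P(x₀)` (`P` monic of degree `M ≥ 1` with a
simple root) the general polynomial fibre is `y₀ = A(x₀) + x₁B(x₀)` (file XLIX).  Along the two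
sheets `x₀ = s^{-2}`, `x₁ = ±Φ(s)s^{-M}` at infinity the fibre value has a meromorphic normal form
`ψ_±(s)s^{L_±}`, `ψ_±(0) ≠ 0` (**`exists_hyperellipticSheet_normalForm`**: isolated zeros; the value
is not identically zero because its product over the two sheets is `(A² − PB²)(x₀) ≠ 0`), so the
pole-fibre dispatcher of files XXXII/XXXVI applies: `M = 1` off the residue class with any `L`,
`M ≥ 3` by the flat sheet with `L ≠ 0` — and **`L₊ = L₋ = 0` is impossible for a non-constant fibre**
(**`hyperellipticSheet_orders_aux`**: the sum of the two sheet values is `2A(x₀)`, the difference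
`2x₁B(x₀)`, one of which is unbounded).  Results: **`unprojectedDensityQuestion_hyperelliptic_sheetFibre`**
— for `deg P ≠ 2` and every `(A, B)` with `B ≠ 0 ∨ deg A ≥ 1`, `{x₁² − P(x₀) = 0, y₀ = A(x₀) + x₁B(x₀)}`
is in Mantova–Masser's case AND dense; **`unprojectedDensityQuestion_hyperelliptic_polyFibre`** — the
same for every `R(x₀, x₁)` non-constant on `C` (examples: file LII).
(The conics `deg P = 2` are file L; constant fibres are files XXII/XXX/XLV, open on one circle when
`deg P ≡ 2 (mod 4)`.)  Decided instances of an OPEN question (Mantova–Masser, PLMS 2024 §1 p. 5);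
EC(3,2) OPEN; NOT Schanuel's conjecture (neither used nor implied); EAC ⇏ SC.
-/

noncomputable section

open Filter Topology Set Complex Polynomial
open Literature.NumberTheory.Transcendental Literature.ModelTheory.Zilber
open Literature.ModelTheory.ExponentialFields

set_option linter.dupNamespace false

namespace Summit.Schanuel.Schanuel.Theorems

section Hyperelliptic

variable (P A B : ℂ[X])

/-! ## Part A. The meromorphic normal form of the fibre value along a sheet -/

/-- **Normal form along a sheet.**  `Φ` a sheet of `x₁² = P(x₀)` at infinity (`x₀ = s^{-2}`,
`x₁ = Φ(s)s^{-M}`), `A² − PB² ≠ 0`: `A(x₀) + x₁B(x₀) = ψ(s)s^{L}` for small `s ≠ 0`, `ψ` analytic,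
`ψ(0) ≠ 0`, `L ∈ ℤ`. [folklore] -/
theorem exists_hyperellipticSheet_normalForm {Φ : ℂ → ℂ} (hΦan : AnalyticAt ℂ Φ 0)
    (hsheet : ∀ᶠ s in 𝓝[≠] (0 : ℂ), (Φ s * (s ^ P.natDegree)⁻¹) ^ 2 - P.eval (s ^ 2)⁻¹ = 0)
    (hN : A ^ 2 - P * B ^ 2 ≠ 0) :
    ∃ (ψ : ℂ → ℂ) (L : ℤ), AnalyticAt ℂ ψ 0 ∧ ψ 0 ≠ 0 ∧
      ∀ᶠ s in 𝓝[≠] (0 : ℂ),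
        A.eval (s ^ 2)⁻¹ + Φ s * (s ^ P.natDegree)⁻¹ * B.eval (s ^ 2)⁻¹ = ψ s * s ^ L := by
  set M : ℕ := P.natDegree with hMdef
  set a : ℕ := A.natDegree with ha
  set b : ℕ := B.natDegree with hb
  obtain ⟨UA, hUAan, -, hUAev⟩ :=
    exists_polarForm_eval A (U := fun _ : ℂ => (1 : ℂ)) analyticAt_const (k := 2) (by norm_num)
  obtain ⟨UB, hUBan, -, hUBev⟩ :=
    exists_polarForm_eval B (U := fun _ : ℂ => (1 : ℂ)) analyticAt_const (k := 2) (by norm_num)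
  set g : ℂ → ℂ := fun s => s ^ (M + 2 * b) * UA s + s ^ (2 * a) * (Φ s * UB s) with hg
  have hid : AnalyticAt ℂ (fun s : ℂ => s) 0 := analyticAt_id
  have hgan : AnalyticAt ℂ g 0 := ((hid.pow _).mul hUAan).add ((hid.pow _).mul (hΦan.mul hUBan))
  have hgf : ∀ s : ℂ, s ≠ 0 → A.eval (s ^ 2)⁻¹ + Φ s * (s ^ M)⁻¹ * B.eval (s ^ 2)⁻¹ =
      g s * s ^ (-((2 * a + M + 2 * b : ℕ) : ℤ)) := by
    intro s hs
    have hA := hUAev s hs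
    have hB := hUBev s hs
    rw [one_mul, inv_pow] at hA hB
    rw [hA, hB, zpow_neg, zpow_natCast, hg, ← ha, ← hb]
    simp only [inv_pow]
    field_simp
    ring
  have hg_ne : ¬ ∀ᶠ s in 𝓝 (0 : ℂ), g s = 0 := by
    intro hg0
    set N : ℂ[X] := A ^ 2 - P * B ^ 2 with hNdef
    obtain ⟨UN, hUNan, hUN0, hUNev⟩ :=
      exists_polarForm_eval N (U := fun _ : ℂ => (1 : ℂ)) analyticAt_const (k := 2) (by norm_num)
    rw [one_pow, mul_one] at hUN0
    have hUNne : ∀ᶠ s in 𝓝 (0 : ℂ), UN s ≠ 0 :=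
      hUNan.continuousAt.eventually_ne (by rw [hUN0]; exact Polynomial.leadingCoeff_ne_zero.2 hN)
    obtain ⟨s, hs0, hgs, hsh, hUs⟩ := ((eventually_mem_nhdsWithin :
        ∀ᶠ s in 𝓝[≠] (0 : ℂ), s ∈ ({(0 : ℂ)}ᶜ : Set ℂ)).and
      ((eventually_nhdsWithin_of_eventually_nhds hg0).and
        (hsheet.and (eventually_nhdsWithin_of_eventually_nhds hUNne)))).exists
    have hs0' : s ≠ 0 := hs0
    have hz : (Φ s * (s ^ M)⁻¹) ^ 2 = P.eval (s ^ 2)⁻¹ := sub_eq_zero.1 hsh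
    have hf0 : A.eval (s ^ 2)⁻¹ + Φ s * (s ^ M)⁻¹ * B.eval (s ^ 2)⁻¹ = 0 := by
      rw [hgf s hs0', hgs, zero_mul]
    have hNev : N.eval (s ^ 2)⁻¹ = 0 := by
      have hA' : A.eval (s ^ 2)⁻¹ = -(Φ s * (s ^ M)⁻¹ * B.eval (s ^ 2)⁻¹) :=
        eq_neg_of_add_eq_zero_left hf0
      rw [hNdef, ← sheet_mul_sheet_eq P A B hz, hA']
      ring
    have hN' := hUNev s hs0'
    rw [one_mul, inv_pow] at hN'
    rw [hN'] at hNev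
    exact (mul_ne_zero hUs (pow_ne_zero _ (inv_ne_zero hs0'))) hNev
  obtain ⟨m, ψ, hψan, hψ0, hgψ⟩ := hgan.exists_eventuallyEq_pow_smul_nonzero_iff.2 hg_ne
  refine ⟨ψ, (m : ℤ) - ((2 * a + M + 2 * b : ℕ) : ℤ), hψan, hψ0, ?_⟩
  filter_upwards [eventually_nhdsWithin_of_eventually_nhds hgψ, self_mem_nhdsWithin] with s h2 hs0
  have hs0' : s ≠ 0 := hs0
  rw [hgf s hs0', h2, sub_zero, smul_eq_mul, zpow_sub₀ hs0', zpow_natCast, zpow_neg, zpow_natCast,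
    div_eq_mul_inv]
  ring

/-! ## Part B. The orders on the two sheets are not both zero -/

/-- **A non-constant fibre value cannot have finite nonzero limits on BOTH sheets**
(`B ≠ 0 ∨ deg A ≥ 1`, `M ≥ 1`, `Φ(0) ≠ 0`): the difference of the two sheet values is
`2x₁B(x₀)`, the sum `2A(x₀)`, and one of them is unbounded as `x₀ → ∞`. [folklore] -/
theorem hyperellipticSheet_orders_aux (hM : 1 ≤ P.natDegree) (hAB : B ≠ 0 ∨ 1 ≤ A.natDegree)
    {Φ : ℂ → ℂ} (hΦan : AnalyticAt ℂ Φ 0) (hΦ0 : Φ 0 ≠ 0) {ψ₁ ψ₂ : ℂ → ℂ}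
    (hψ₁ : AnalyticAt ℂ ψ₁ 0) (hψ₂ : AnalyticAt ℂ ψ₂ 0)
    (h₁ : ∀ᶠ s in 𝓝[≠] (0 : ℂ),
      A.eval (s ^ 2)⁻¹ + Φ s * (s ^ P.natDegree)⁻¹ * B.eval (s ^ 2)⁻¹ = ψ₁ s)
    (h₂ : ∀ᶠ s in 𝓝[≠] (0 : ℂ),
      A.eval (s ^ 2)⁻¹ + (-Φ) s * (s ^ P.natDegree)⁻¹ * B.eval (s ^ 2)⁻¹ = ψ₂ s) : False := by
  set M : ℕ := P.natDegree with hMdef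
  have hψ₁t : Tendsto ψ₁ (𝓝[≠] (0 : ℂ)) (𝓝 (ψ₁ 0)) :=
    hψ₁.continuousAt.tendsto.mono_left nhdsWithin_le_nhds
  have hψ₂t : Tendsto ψ₂ (𝓝[≠] (0 : ℂ)) (𝓝 (ψ₂ 0)) :=
    hψ₂.continuousAt.tendsto.mono_left nhdsWithin_le_nhds
  have hinv : Tendsto (fun s : ℂ => ‖s⁻¹‖) (𝓝[≠] (0 : ℂ)) atTop := tendsto_norm_inv_nhdsNE_zero_atTop
  rcases hAB with hB | hA
  · -- the difference `2x₁B(x₀) = 2Φ(s)U_B(s)·s⁻¹^{M + 2b}` is unbounded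
    obtain ⟨UB, hUBan, hUB0, hUBev⟩ :=
      exists_polarForm_eval B (U := fun _ : ℂ => (1 : ℂ)) analyticAt_const (k := 2) (by norm_num)
    rw [one_pow, mul_one] at hUB0
    have hdiff : Tendsto (fun s => 2 * (Φ s * (s ^ M)⁻¹ * B.eval (s ^ 2)⁻¹)) (𝓝[≠] (0 : ℂ))
        (𝓝 (ψ₁ 0 - ψ₂ 0)) := by
      refine (hψ₁t.sub hψ₂t).congr' ?_
      filter_upwards [h₁, h₂] with s e1 e2
      rw [← e1, ← e2, Pi.neg_apply]
      ring
    have hc : Tendsto (fun s => ‖2 * (Φ s * UB s)‖) (𝓝[≠] (0 : ℂ)) (𝓝 ‖2 * (Φ 0 * UB 0)‖) :=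
      ((hΦan.continuousAt.tendsto.mul hUBan.continuousAt.tendsto).const_mul 2 |>.mono_left
        nhdsWithin_le_nhds).norm
    have hpos : 0 < ‖2 * (Φ 0 * UB 0)‖ := by
      rw [norm_pos_iff, hUB0]
      exact mul_ne_zero two_ne_zero (mul_ne_zero hΦ0 (Polynomial.leadingCoeff_ne_zero.2 hB))
    have hpow : Tendsto (fun s : ℂ => ‖s⁻¹‖ ^ (M + 2 * B.natDegree)) (𝓝[≠] (0 : ℂ)) atTop :=
      (tendsto_pow_atTop (by omega : M + 2 * B.natDegree ≠ 0)).comp hinv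
    have hnorm : Tendsto (fun s => ‖2 * (Φ s * (s ^ M)⁻¹ * B.eval (s ^ 2)⁻¹)‖) (𝓝[≠] (0 : ℂ))
        atTop := by
      refine (hc.pos_mul_atTop hpos hpow).congr' ?_
      filter_upwards [self_mem_nhdsWithin] with s hs0
      have hs0' : s ≠ 0 := hs0
      have hB' := hUBev s hs0'
      rw [one_mul, inv_pow] at hB'
      rw [hB', ← inv_pow, ← norm_pow, ← norm_mul]
      congr 1
      ring
    exact not_tendsto_atTop_of_tendsto_nhds hdiff.norm hnorm
  · -- the sum `2A(x₀) = 2U_A(s)·s⁻¹^{2a}` is unbounded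
    have hA0 : A ≠ 0 := by
      rintro rfl
      simp at hA
    obtain ⟨UA, hUAan, hUA0, hUAev⟩ :=
      exists_polarForm_eval A (U := fun _ : ℂ => (1 : ℂ)) analyticAt_const (k := 2) (by norm_num)
    rw [one_pow, mul_one] at hUA0
    have hsum : Tendsto (fun s => 2 * A.eval (s ^ 2)⁻¹) (𝓝[≠] (0 : ℂ)) (𝓝 (ψ₁ 0 + ψ₂ 0)) := by
      refine (hψ₁t.add hψ₂t).congr' ?_
      filter_upwards [h₁, h₂] with s e1 e2
      rw [← e1, ← e2, Pi.neg_apply]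
      ring
    have hc : Tendsto (fun s => ‖2 * UA s‖) (𝓝[≠] (0 : ℂ)) (𝓝 ‖2 * UA 0‖) :=
      (hUAan.continuousAt.tendsto.const_mul 2 |>.mono_left nhdsWithin_le_nhds).norm
    have hpos : 0 < ‖2 * UA 0‖ := by
      rw [norm_pos_iff, hUA0]
      exact mul_ne_zero two_ne_zero (Polynomial.leadingCoeff_ne_zero.2 hA0)
    have hpow : Tendsto (fun s : ℂ => ‖s⁻¹‖ ^ (2 * A.natDegree)) (𝓝[≠] (0 : ℂ)) atTop :=
      (tendsto_pow_atTop (by omega : 2 * A.natDegree ≠ 0)).comp hinv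
    have hnorm : Tendsto (fun s => ‖2 * A.eval (s ^ 2)⁻¹‖) (𝓝[≠] (0 : ℂ)) atTop := by
      refine (hc.pos_mul_atTop hpos hpow).congr' ?_
      filter_upwards [self_mem_nhdsWithin] with s hs0
      have hs0' : s ≠ 0 := hs0
      have hA' := hUAev s hs0'
      rw [one_mul, inv_pow] at hA'
      rw [hA', ← norm_pow, ← norm_mul]
      congr 1
      ring
    exact not_tendsto_atTop_of_tendsto_nhds hsum.norm hnorm

/-! ## Part C. Density -/

/-- **`y₀ = A(x₀) + x₁B(x₀)` over `x₁² = P(x₀)`, `deg P ≠ 2`: dense** (`P` monic of degree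
`M ≥ 1`, `M ≠ 2`, with a simple root; `B ≠ 0 ∨ deg A ≥ 1`).  `M = 1`: principal sheet off the
residue class (file XXXII); `M ≥ 3`: the flat sheet `±Φ` whose order `L_±` is nonzero (file XXXVI).
[cite: MantovaMasser2023, §1 Further remarks, p. 5 (the question, open in general)] (new) -/
theorem unprojectedDense_hyperelliptic_sheetFibre (hAB : B ≠ 0 ∨ 1 ≤ A.natDegree) (hP : P.Monic)
    (hM : 1 ≤ P.natDegree) (hM2 : P.natDegree ≠ 2) {r : ℂ} (hr : P.IsRoot r)
    (hr1 : P.derivative.eval r ≠ 0) :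
    UnprojectedDense {w : Fin 2 ⊕ Fin 2 → ℂ |
      MvPolynomial.eval ![w (Sum.inl 0), w (Sum.inl 1)]
          (MvPolynomial.X 1 ^ 2 - Polynomial.aeval (MvPolynomial.X 0 : MvPolynomial (Fin 2) ℂ) P) = 0 ∧
      w (Sum.inr 0) = MvPolynomial.eval ![w (Sum.inl 0), w (Sum.inl 1)]
        (Polynomial.aeval (MvPolynomial.X 0 : MvPolynomial (Fin 2) ℂ) A +
          MvPolynomial.X 1 * Polynomial.aeval (MvPolynomial.X 0 : MvPolynomial (Fin 2) ℂ) B)} := by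
  classical
  set M : ℕ := P.natDegree with hMdef
  have hAB' : A ≠ 0 ∨ B ≠ 0 := by
    rcases hAB with hB | hA
    · exact Or.inr hB
    · left
      rintro rfl
      simp at hA
  have hN : A ^ 2 - P * B ^ 2 ≠ 0 := sq_sub_mul_sq_ne_zero P A B hr hr1 hAB'
  have hirr := irreducible_superellipticMv P (by norm_num : 1 ≤ 2) hr hr1
  have hS := isIrreducibleClosed_curveGraphFibre
    (Polynomial.aeval (MvPolynomial.X 0 : MvPolynomial (Fin 2) ℂ) A +
      MvPolynomial.X 1 * Polynomial.aeval (MvPolynomial.X 0 : MvPolynomial (Fin 2) ℂ) B) hirr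
  have hdim := zariskiDim_curveGraphFibre
    (Polynomial.aeval (MvPolynomial.X 0 : MvPolynomial (Fin 2) ℂ) A +
      MvPolynomial.X 1 * Polynomial.aeval (MvPolynomial.X 0 : MvPolynomial (Fin 2) ℂ) B) hirr
  obtain ⟨Φ, hΦan, hΦ0, hflat, hsheet⟩ :=
    superelliptic_sheet_facts_flat P (k := 2) (by norm_num) hP hM (one_pow 2)
  -- the opposite sheet `−Φ`
  have hΦan' : AnalyticAt ℂ (-Φ) 0 := hΦan.neg
  have hsheet' : ∀ᶠ s in 𝓝[≠] (0 : ℂ), ((-Φ) s * (s ^ M)⁻¹) ^ 2 - P.eval (s ^ 2)⁻¹ = 0 := by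
    filter_upwards [hsheet] with s hs
    rw [Pi.neg_apply, neg_mul, neg_sq]
    exact hs
  have hflat' : ∃ K : ℝ, ∀ᶠ s in 𝓝 (0 : ℂ), ‖(-Φ) s - (-Φ) 0‖ ≤ K * ‖s‖ ^ 2 := by
    obtain ⟨K, hK⟩ := hflat
    refine ⟨K, ?_⟩
    filter_upwards [hK] with s hs
    rw [Pi.neg_apply, Pi.neg_apply, neg_sub_neg, norm_sub_rev]
    exact hs
  obtain ⟨ψ₁, L₁, hψ₁, hψ₁0, hf₁⟩ := exists_hyperellipticSheet_normalForm P A B hΦan hsheet hN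
  obtain ⟨ψ₂, L₂, hψ₂, hψ₂0, hf₂⟩ := exists_hyperellipticSheet_normalForm P A B hΦan' hsheet' hN
  -- the cylinder germs lie in the surface
  have hgerm : ∀ {Θ ψ : ℂ → ℂ} {L : ℤ},
      (∀ᶠ s in 𝓝[≠] (0 : ℂ), (Θ s * (s ^ M)⁻¹) ^ 2 - P.eval (s ^ 2)⁻¹ = 0) →
      (∀ᶠ s in 𝓝[≠] (0 : ℂ),
        A.eval (s ^ 2)⁻¹ + Θ s * (s ^ M)⁻¹ * B.eval (s ^ 2)⁻¹ = ψ s * s ^ L) →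
      ∀ᶠ s in 𝓝[≠] (0 : ℂ), (Sum.elim ![(s ^ 2)⁻¹, Θ s * (s ^ M)⁻¹]
          ![ψ s * s ^ L, Complex.exp (Θ s * (s ^ M)⁻¹)] : Fin 2 ⊕ Fin 2 → ℂ) ∈
        {w : Fin 2 ⊕ Fin 2 → ℂ |
          MvPolynomial.eval ![w (Sum.inl 0), w (Sum.inl 1)]
              (MvPolynomial.X 1 ^ 2 - Polynomial.aeval (MvPolynomial.X 0 : MvPolynomial (Fin 2) ℂ) P) = 0 ∧
          w (Sum.inr 0) = MvPolynomial.eval ![w (Sum.inl 0), w (Sum.inl 1)]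
            (Polynomial.aeval (MvPolynomial.X 0 : MvPolynomial (Fin 2) ℂ) A +
              MvPolynomial.X 1 * Polynomial.aeval (MvPolynomial.X 0 : MvPolynomial (Fin 2) ℂ) B)} := by
    intro Θ ψ L hsh hf
    filter_upwards [hsh, hf] with s hs hfs
    refine ⟨?_, ?_⟩
    · simp only [Sum.elim_inl, Matrix.cons_val_zero, Matrix.cons_val_one]
      rw [eval_superellipticMv]
      simpa only [Matrix.cons_val_zero, Matrix.cons_val_one] using hs
    · simp only [Sum.elim_inr, Sum.elim_inl, Matrix.cons_val_zero, Matrix.cons_val_one]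
      rw [eval_sheetFibreMv]
      simp only [Matrix.cons_val_zero, Matrix.cons_val_one]
      exact hfs.symm
  by_cases hM1 : M = 1
  · refine unprojectedDense_branch_poleFibre_of_not_residue hS (le_of_eq hdim) (k := 2) (M := M)
      (by norm_num) hM ?_ L₁ hψ₁ hψ₁0 hΦan hΦ0 (hgerm hsheet hf₁)
    rw [hM1]
    decide
  · have h2M : 2 < M := by omega
    by_cases hL₁ : L₁ ≠ 0
    · exact unprojectedDense_branch_poleFibre_of_flat hS (le_of_eq hdim) (by norm_num) h2M hL₁ hψ₁
        hψ₁0 hΦan (by rw [hΦ0]; exact one_ne_zero) hflat (hgerm hsheet hf₁)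
    · by_cases hL₂ : L₂ ≠ 0
      · exact unprojectedDense_branch_poleFibre_of_flat hS (le_of_eq hdim) (by norm_num) h2M hL₂ hψ₂
          hψ₂0 hΦan' (by rw [Pi.neg_apply, hΦ0]; norm_num) hflat' (hgerm hsheet' hf₂)
      · exfalso
        push Not at hL₁ hL₂
        refine hyperellipticSheet_orders_aux P A B hM hAB hΦan (by rw [hΦ0]; exact one_ne_zero)
          hψ₁ hψ₂ ?_ ?_
        · filter_upwards [hf₁] with s hs
          rw [hs, hL₁, zpow_zero, mul_one]
        · filter_upwards [hf₂] with s hs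
          rw [hs, hL₂, zpow_zero, mul_one]

/-! ## Part D. The packaged statements -/

/-- **Mantova–Masser's question for `y₀ = A(x₀) + x₁B(x₀)` over `x₁² = P(x₀)`, `deg P ≠ 2`:
case ∧ dense** (`P` monic of degree `≥ 1`, `≠ 2`, with a simple root; `B ≠ 0 ∨ deg A ≥ 1`).
[cite: MantovaMasser2023, §1 Further remarks, p. 5 (the question, open in general)] (new) -/
theorem unprojectedDensityQuestion_hyperelliptic_sheetFibre (hAB : B ≠ 0 ∨ 1 ≤ A.natDegree)
    (hP : P.Monic) (hM : 1 ≤ P.natDegree) (hM2 : P.natDegree ≠ 2) {r : ℂ} (hr : P.IsRoot r)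
    (hr1 : P.derivative.eval r ≠ 0) :
    MMCaseDimPiOneFree {w : Fin 2 ⊕ Fin 2 → ℂ |
        MvPolynomial.eval ![w (Sum.inl 0), w (Sum.inl 1)]
            (MvPolynomial.X 1 ^ 2 - Polynomial.aeval (MvPolynomial.X 0 : MvPolynomial (Fin 2) ℂ) P) = 0 ∧
        w (Sum.inr 0) = MvPolynomial.eval ![w (Sum.inl 0), w (Sum.inl 1)]
          (Polynomial.aeval (MvPolynomial.X 0 : MvPolynomial (Fin 2) ℂ) A +
            MvPolynomial.X 1 * Polynomial.aeval (MvPolynomial.X 0 : MvPolynomial (Fin 2) ℂ) B)} ∧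
      UnprojectedDense {w : Fin 2 ⊕ Fin 2 → ℂ |
        MvPolynomial.eval ![w (Sum.inl 0), w (Sum.inl 1)]
            (MvPolynomial.X 1 ^ 2 - Polynomial.aeval (MvPolynomial.X 0 : MvPolynomial (Fin 2) ℂ) P) = 0 ∧
        w (Sum.inr 0) = MvPolynomial.eval ![w (Sum.inl 0), w (Sum.inl 1)]
          (Polynomial.aeval (MvPolynomial.X 0 : MvPolynomial (Fin 2) ℂ) A +
            MvPolynomial.X 1 * Polynomial.aeval (MvPolynomial.X 0 : MvPolynomial (Fin 2) ℂ) B)} := by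
  have hAB' : A ≠ 0 ∨ B ≠ 0 := by
    rcases hAB with hB | hA
    · exact Or.inr hB
    · left
      rintro rfl
      simp at hA
  exact ⟨mmCase_hyperelliptic_sheetFibre P A B hAB' hr hr1,
    unprojectedDense_hyperelliptic_sheetFibre P A B hAB hP hM hM2 hr hr1⟩

/-- **A polynomial non-constant on the curve has a non-constant reduction.** [folklore] -/
theorem reduction_nonconstant (R Q : MvPolynomial (Fin 2) ℂ)
    (hRAB : R = Polynomial.aeval (MvPolynomial.X 0 : MvPolynomial (Fin 2) ℂ) A +
        MvPolynomial.X 1 * Polynomial.aeval (MvPolynomial.X 0 : MvPolynomial (Fin 2) ℂ) B +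
        (MvPolynomial.X 1 ^ 2 - Polynomial.aeval (MvPolynomial.X 0 : MvPolynomial (Fin 2) ℂ) P) * Q)
    (hR : ∃ x y : Fin 2 → ℂ,
      MvPolynomial.eval x
          (MvPolynomial.X 1 ^ 2 - Polynomial.aeval (MvPolynomial.X 0 : MvPolynomial (Fin 2) ℂ) P) = 0 ∧
        MvPolynomial.eval y
          (MvPolynomial.X 1 ^ 2 - Polynomial.aeval (MvPolynomial.X 0 : MvPolynomial (Fin 2) ℂ) P) = 0 ∧
        MvPolynomial.eval x R ≠ MvPolynomial.eval y R) :
    B ≠ 0 ∨ 1 ≤ A.natDegree := by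
  by_contra h
  push Not at h
  obtain ⟨hB, hA⟩ := h
  have hA0 : A = Polynomial.C (A.coeff 0) := Polynomial.eq_C_of_natDegree_eq_zero (by omega)
  obtain ⟨x, y, hx, hy, hxy⟩ := hR
  apply hxy
  rw [hRAB, hB, map_add, map_add, map_mul, map_mul, hx, map_add, map_add, map_mul, map_mul, hy,
    Literature.ModelTheory.Zilber.eval_polynomial_aeval_X,
    Literature.ModelTheory.Zilber.eval_polynomial_aeval_X, hA0]
  simp

/-- **EVERY polynomial fibre non-constant on the curve, over `x₁² = P(x₀)` with `deg P ≠ 2`: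
case ∧ dense.**  `P` monic of degree `≥ 1`, `≠ 2`, with a simple root; `R ∈ ℂ[x₀, x₁]` taking two
different values on the curve: `{x₁² − P(x₀) = 0, y₀ = R(x₀, x₁)}` is in Mantova–Masser's case AND
has Zariski-dense exponential points. [cite: MantovaMasser2023, §1 Further remarks, p. 5 (the
question, open in general)] (new) -/
theorem unprojectedDensityQuestion_hyperelliptic_polyFibre (R : MvPolynomial (Fin 2) ℂ)
    (hR : ∃ x y : Fin 2 → ℂ,
      MvPolynomial.eval x
          (MvPolynomial.X 1 ^ 2 - Polynomial.aeval (MvPolynomial.X 0 : MvPolynomial (Fin 2) ℂ) P) = 0 ∧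
        MvPolynomial.eval y
          (MvPolynomial.X 1 ^ 2 - Polynomial.aeval (MvPolynomial.X 0 : MvPolynomial (Fin 2) ℂ) P) = 0 ∧
        MvPolynomial.eval x R ≠ MvPolynomial.eval y R)
    (hP : P.Monic) (hM : 1 ≤ P.natDegree) (hM2 : P.natDegree ≠ 2) {r : ℂ} (hr : P.IsRoot r)
    (hr1 : P.derivative.eval r ≠ 0) :
    MMCaseDimPiOneFree {w : Fin 2 ⊕ Fin 2 → ℂ |
        MvPolynomial.eval ![w (Sum.inl 0), w (Sum.inl 1)]
            (MvPolynomial.X 1 ^ 2 - Polynomial.aeval (MvPolynomial.X 0 : MvPolynomial (Fin 2) ℂ) P) = 0 ∧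
        w (Sum.inr 0) = MvPolynomial.eval ![w (Sum.inl 0), w (Sum.inl 1)] R} ∧
      UnprojectedDense {w : Fin 2 ⊕ Fin 2 → ℂ |
        MvPolynomial.eval ![w (Sum.inl 0), w (Sum.inl 1)]
            (MvPolynomial.X 1 ^ 2 - Polynomial.aeval (MvPolynomial.X 0 : MvPolynomial (Fin 2) ℂ) P) = 0 ∧
        w (Sum.inr 0) = MvPolynomial.eval ![w (Sum.inl 0), w (Sum.inl 1)] R} := by
  obtain ⟨A', B', Q, hRAB⟩ := exists_hyperelliptic_reduction P R
  rw [curveGraphFibre_eq_of_reduction P A' B' R Q hRAB]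
  exact unprojectedDensityQuestion_hyperelliptic_sheetFibre P A' B'
    (reduction_nonconstant P A' B' R Q hRAB hR) hP hM hM2 hr hr1

/-- **Plain coordinates**: `{x₁² − P(x₀) = 0, y₀ = A(x₀) + x₁B(x₀)}` is in the case AND dense
(hypotheses as above). [cite: MantovaMasser2023, §1 Further remarks, p. 5 (the question, open in
general)] (new) -/
theorem unprojectedDensityQuestion_hyperelliptic_sheetFibre' (hAB : B ≠ 0 ∨ 1 ≤ A.natDegree)
    (hP : P.Monic) (hM : 1 ≤ P.natDegree) (hM2 : P.natDegree ≠ 2) {r : ℂ} (hr : P.IsRoot r)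
    (hr1 : P.derivative.eval r ≠ 0) :
    MMCaseDimPiOneFree {w : Fin 2 ⊕ Fin 2 → ℂ |
        w (Sum.inl 1) ^ 2 - P.eval (w (Sum.inl 0)) = 0 ∧
        w (Sum.inr 0) = A.eval (w (Sum.inl 0)) + w (Sum.inl 1) * B.eval (w (Sum.inl 0))} ∧
      UnprojectedDense {w : Fin 2 ⊕ Fin 2 → ℂ |
        w (Sum.inl 1) ^ 2 - P.eval (w (Sum.inl 0)) = 0 ∧
        w (Sum.inr 0) = A.eval (w (Sum.inl 0)) + w (Sum.inl 1) * B.eval (w (Sum.inl 0))} := by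
  rw [← sheetFibre_setOf_eq]
  exact unprojectedDensityQuestion_hyperelliptic_sheetFibre P A B hAB hP hM hM2 hr hr1

end Hyperelliptic

end Summit.Schanuel.Schanuel.Theorems

end
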